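import Literature.NumberTheory.Sieve.HeathBrownCubicTwistedSmallQ
import HarnessLib

/-!
# Heath-Brown's Lemma 3.10 for a twisted weight: §13 pp. 81–83, `∑_{q ≤ d₀} w(q) U*(C, q)` for one cube

D. R. Heath-Brown, *Primes represented by `x³ + 2y³`*, Acta Math. 186 (2001), §13 pp. 81–83, for the
twisted weight `F'(w) = w(β̂) f_(β)[β̂ primitive]`, `w` `d`-periodic with `|w| ≤ 1` (Heath-Brown–Moroz
2004, Prop. 4.2 (ii)): the tree's `sum_wt_Ustar_le` (`HeathBrownCubicTypeIIUstarBound`) re-run with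
the twisted small-`q` bound `Twisted.norm_Sfrac_Fprim_le` ((3.14) at level `d·Q₁`, constant `d³C₁`) and the
dyadic large sieve (generic weights). PROVED: `sum_wt_Ustar_le` (twisted; the `q ≤ Q₀` term carries
`(d³C₁)²`, the `q > Q₀` term `∑ F'(w)²`).

## References

* D. R. Heath-Brown, Acta Math. 186 (2001), §13 pp. 81–83. [cite: HeathBrownActa2001, §13 pp. 81–83]
* D. R. Heath-Brown, B. Z. Moroz, Proc. London Math. Soc. 88 (2004), Prop. 4.2. [cite: HeathBrownMoroz2004, Proposition 4.2]

## Mathlib / tree search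

Tree: `HeathBrownCubicTypeIIUstarBound` (`sum_wt_Ustar_le`, `blockIdx`, `mem_block_of_gt`, `blockIdx_lt`,
`block_le`, `geom_sums`), `HeathBrownCubicTypeIILSBridge` (`sum_Ustar_dyadic_le`), `HeathBrownCubicTypeIIWeights`
(`wt_le`, `Ustar_le_of_bound`).
-/

noncomputable section

open Finset NumberField

namespace Literature.NumberTheory.Sieve.CubicSieve.Twisted

open LFunctions.CubeRootTwoField CubicPrimes CubicSieve LargeSieve

set_option maxHeartbeats 1000000 in
open scoped Classical in
/-- **`∑_{q ≤ d₀} w(q) U*(C, q)` for a cube `C` satisfying the conditions of (3.14)** (`Q₀ ≥ 1`, `Q₀ ≤ Q₁`,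
`d₀ ≥ 1`, `Δ₀ > 0`): the range `q ≤ Q₀` by (3.14) and Hölder, the range `q > Q₀` by the dyadic large sieve.
[cite: HeathBrownActa2001, §13 pp. 81–83] -/
theorem sum_wt_Ustar_le {X τ : ℝ} (hX : 1 < X) (hτ : 0 < τ) (hτ1 : τ ≤ 1) {nn : ℕ} {m : Fin (nn + 1) → ℕ}
    (hm : CoreAdmissible τ m) {Q₁ C₁ c₁ c₃ c₄ : ℝ} {d : ℕ} (hd : 0 < d)
    (hHyp : Hyp314 X τ m ((d : ℝ) * Q₁) C₁ c₁ c₃ c₄) {w : ℤ × ℤ × ℤ → ℝ} (hw1 : ∀ b, |w b| ≤ 1)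
    (hwper : ∀ b u, DvdVec (d : ℤ) u → w (b + u) = w b) {V : ℝ} (hV : 0 < V)
    {a : ℝ × ℝ × ℝ} {S₀ : ℝ} (hS : 0 ≤ S₀) (hsL : hbL X τ ^ 2 ≤ S₀) (hcube : CubeCond c₃ c₄ V a S₀)
    (hC0 : ∀ v ∈ latticeCube a S₀, v ≠ 0) {M : ℕ} (hM : ∀ v ∈ latticeCube a S₀, hcf3 v ≤ M)
    {Q₀ : ℕ} (hQ₀ : 1 ≤ Q₀) (hQ₀₁ : (Q₀ : ℝ) ≤ Q₁) {Δ₀ : ℝ} (hΔ : 0 < Δ₀) {d₀ : ℝ} (hd₀ : 1 ≤ d₀) (Dmax : ℕ) :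
    ∑ q ∈ Icc 1 ⌊d₀⌋₊, wt Δ₀ Dmax d₀ q * Ustar (Fprim X τ m w) (latticeCube a S₀) q ≤
      4 * (1 + Real.log Q₀) / Δ₀ * (Q₀ : ℝ) ^ 3 *
          (2 * ((Q₀ : ℝ) ^ 4 * Q₁ ^ 2 * ((d : ℝ) ^ 3 * (C₁ * V * Real.exp (-(c₁ * Real.sqrt (Real.log (hbL X τ)))))) ^ 2 +
            162 * ((∑ v ∈ latticeCube a S₀, (idealDivisorCount (Ideal.span {coordElt v}) : ℝ) ^ 3) ^ (1 / 3 : ℝ)) ^ 2 *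
              (∑ g ∈ Ioc ⌊Q₁ / Q₀⌋₊ M, (S₀ / g + 1) ^ 2) ^ 2)) +
        414720 * (1 + Real.log (2 * d₀)) / Δ₀ *
          ((((⌊S₀⌋₊ + 1 : ℕ) : ℝ)) ^ 3 / Q₀ + d₀ * (((⌊S₀⌋₊ + 1 : ℕ) : ℝ)) ^ 2 + d₀ ^ 3) *
          ∑ v ∈ latticeCube a S₀, Fprim X τ m w v ^ 2 := by
  classical
  set C := latticeCube a S₀ with hC
  set F := Fprim X τ m w with hF
  set H : ℝ := (d : ℝ) ^ 3 * (C₁ * V * Real.exp (-(c₁ * Real.sqrt (Real.log (hbL X τ))))) with hH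
  set S3r : ℝ := (∑ v ∈ C, (idealDivisorCount (Ideal.span {coordElt v}) : ℝ) ^ 3) ^ (1 / 3 : ℝ) with hS3r
  set G : ℝ := Q₁ / Q₀ with hG
  set R : ℝ := ∑ g ∈ Ioc ⌊G⌋₊ M, (S₀ / g + 1) ^ 2 with hR
  set N' : ℕ := ⌊S₀⌋₊ + 1 with hN'
  set F2 : ℝ := ∑ v ∈ C, F v ^ 2 with hF2
  have hQR : (0 : ℝ) < Q₀ := by exact_mod_cast hQ₀
  have hQR1 : (1 : ℝ) ≤ Q₀ := by exact_mod_cast hQ₀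
  have hG1 : 1 ≤ G := by rw [hG, le_div_iff₀ hQR]; linarith
  have hQG : (Q₀ : ℝ) * G = Q₁ := by rw [hG]; field_simp
  have hS3r0 : 0 ≤ S3r := Real.rpow_nonneg (sum_nonneg fun v _ => by positivity) _
  have hR0 : 0 ≤ R := sum_nonneg fun g _ => by positivity
  have hF20 : 0 ≤ F2 := sum_nonneg fun v _ => by positivity
  clear_value F2
  have hH0 : 0 ≤ H := by
    have h1 : (1 : ℝ) ≤ (d : ℝ) * Q₁ := by
      have hd1 : (1 : ℝ) ≤ d := by exact_mod_cast hd
      nlinarith [hQR1.trans hQ₀₁]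
    have := hHyp 1 le_rfl (by simpa using h1) 0 V a S₀ hV hsL hcube
    have h0 := (abs_nonneg _).trans this
    rw [hH]; positivity
  have hlogQ : 0 ≤ Real.log Q₀ := Real.log_nonneg hQR1
  have hlogd : 0 ≤ Real.log (2 * d₀) := Real.log_nonneg (by linarith)
  have hwt : ∀ q : ℕ, 1 ≤ q → wt Δ₀ Dmax d₀ q ≤ 4 * (1 + Real.log q) / (q * Δ₀) := fun q hq => wt_le hΔ Dmax d₀ hq
  -- split at `Q₀`
  rw [← sum_filter_add_sum_filter_not (Icc 1 ⌊d₀⌋₊) (fun q => q ≤ Q₀)]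
  refine add_le_add ?_ ?_
  · ---- small `q`
    set B : ℝ := (Q₀ : ℝ) ^ 3 * G * H + 9 * S3r * R with hB
    have hB0 : 0 ≤ B := by positivity
    have hterm : ∀ q ∈ (Icc 1 ⌊d₀⌋₊).filter (fun q => q ≤ Q₀),
        wt Δ₀ Dmax d₀ q * Ustar F C q ≤ 4 * (1 + Real.log Q₀) / Δ₀ * (Q₀ : ℝ) ^ 2 * B ^ 2 := by
      intro q hq
      rw [mem_filter, mem_Icc] at hq
      obtain ⟨⟨hq1, -⟩, hqQ⟩ := hq
      have hqR : (1 : ℝ) ≤ q := by exact_mod_cast hq1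
      have hqQR : (q : ℝ) ≤ Q₀ := by exact_mod_cast hqQ
      have hqG : (q : ℝ) * G ≤ Q₁ := by rw [← hQG]; exact mul_le_mul_of_nonneg_right hqQR (by linarith)
      -- `|S(b/q)| ≤ B`
      have hSb : ∀ b, ‖Sfrac F C q b‖ ≤ B := by
        intro b
        have h := norm_Sfrac_Fprim_le hX hτ hτ1 hm hd hHyp hw1 hwper hV hS hsL hcube hC0 hM hq1 hG1 hqG b
        rw [← hC, ← hH, ← hS3r, ← hR] at h
        refine h.trans ?_
        rw [hB]
        have : (q : ℝ) ^ 3 * G * H ≤ (Q₀ : ℝ) ^ 3 * G * H := by gcongr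
        linarith
      have hU := Ustar_le_of_bound F C q hB0 hSb
      have hw := hwt q hq1
      have hlogq : Real.log q ≤ Real.log Q₀ := Real.log_le_log (by linarith) hqQR
      have hlogq0 : 0 ≤ Real.log q := Real.log_nonneg hqR
      calc wt Δ₀ Dmax d₀ q * Ustar F C q ≤ (4 * (1 + Real.log q) / (q * Δ₀)) * ((q : ℝ) ^ 3 * B ^ 2) :=
            mul_le_mul hw hU (Ustar_nonneg _ _ _) (by positivity)
        _ = 4 * (1 + Real.log q) / Δ₀ * (q : ℝ) ^ 2 * B ^ 2 := by field_simp
        _ ≤ 4 * (1 + Real.log Q₀) / Δ₀ * (Q₀ : ℝ) ^ 2 * B ^ 2 := by gcongr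
    calc ∑ q ∈ (Icc 1 ⌊d₀⌋₊).filter (fun q => q ≤ Q₀), wt Δ₀ Dmax d₀ q * Ustar F C q
        ≤ ∑ _q ∈ (Icc 1 ⌊d₀⌋₊).filter (fun q => q ≤ Q₀), 4 * (1 + Real.log Q₀) / Δ₀ * (Q₀ : ℝ) ^ 2 * B ^ 2 :=
          sum_le_sum hterm
      _ = #((Icc 1 ⌊d₀⌋₊).filter (fun q => q ≤ Q₀)) * (4 * (1 + Real.log Q₀) / Δ₀ * (Q₀ : ℝ) ^ 2 * B ^ 2) := by
          rw [sum_const, nsmul_eq_mul]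
      _ ≤ Q₀ * (4 * (1 + Real.log Q₀) / Δ₀ * (Q₀ : ℝ) ^ 2 * B ^ 2) := by
          gcongr
          have : (Icc 1 ⌊d₀⌋₊).filter (fun q => q ≤ Q₀) ⊆ Icc 1 Q₀ := by
            intro q hq; rw [mem_filter, mem_Icc] at hq; rw [mem_Icc]; exact ⟨hq.1.1, hq.2⟩
          exact_mod_cast (card_le_card this).trans (by simp)
      _ = 4 * (1 + Real.log Q₀) / Δ₀ * (Q₀ : ℝ) ^ 3 * B ^ 2 := by ring
      _ ≤ 4 * (1 + Real.log Q₀) / Δ₀ * (Q₀ : ℝ) ^ 3 *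
            (2 * ((Q₀ : ℝ) ^ 4 * Q₁ ^ 2 * H ^ 2 + 162 * S3r ^ 2 * R ^ 2)) := by
          gcongr
          rw [hB]
          have e1 : (Q₀ : ℝ) ^ 3 * G = (Q₀ : ℝ) ^ 2 * Q₁ := by
            rw [← hQG]; ring
          rw [e1]
          nlinarith [sq_nonneg ((Q₀ : ℝ) ^ 2 * Q₁ * H - 9 * S3r * R)]
      _ = _ := by ring
  · ---- large `q`: dyadic blocks
    set Sq := (Icc 1 ⌊d₀⌋₊).filter (fun q => ¬q ≤ Q₀) with hSq
    by_cases hempty : Sq = ∅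
    · rw [hempty, sum_empty]
      have : 0 ≤ ((N' : ℝ)) ^ 3 / Q₀ + d₀ * (N' : ℝ) ^ 2 + d₀ ^ 3 := by positivity
      positivity
    -- `⌊d₀/Q₀⌋₊ ≥ 1`
    have hu : 1 ≤ ⌊d₀ / Q₀⌋₊ := by
      obtain ⟨q, hq⟩ := nonempty_iff_ne_empty.mpr hempty
      rw [hSq, mem_filter, mem_Icc] at hq
      obtain ⟨⟨-, hqd⟩, hqQ⟩ := hq
      apply Nat.le_floor
      rw [Nat.cast_one, le_div_iff₀ hQR, one_mul]
      have h1 : (Q₀ : ℝ) < q := by exact_mod_cast (not_le.mp hqQ)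
      have h2 : (q : ℝ) ≤ ⌊d₀⌋₊ := by exact_mod_cast hqd
      have h3 : (⌊d₀⌋₊ : ℝ) ≤ d₀ := Nat.floor_le (by linarith)
      linarith
    set K : ℕ := Nat.log 2 ⌊d₀ / Q₀⌋₊ + 1 with hK
    -- fibre over the block index
    have hmaps : ∀ q ∈ Sq, blockIdx Q₀ q ∈ range K := by
      intro q hq
      rw [hSq, mem_filter, mem_Icc] at hq
      obtain ⟨⟨-, hqd⟩, -⟩ := hq
      rw [mem_range, hK]
      refine blockIdx_lt hQ₀ (le_trans (by exact_mod_cast hqd) (Nat.floor_le (by linarith)))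
    rw [← sum_fiberwise_of_maps_to hmaps]
    -- each block
    have hblock : ∀ j ∈ range K,
        ∑ q ∈ Sq.filter (fun q => blockIdx Q₀ q = j), wt Δ₀ Dmax d₀ q * Ustar F C q ≤
          4 * (1 + Real.log (2 * d₀)) / Δ₀ * 51840 *
            ((N' : ℝ) ^ 3 * ((Q₀ : ℝ) * 2 ^ j)⁻¹ + ((Q₀ : ℝ) * 2 ^ j) * (N' : ℝ) ^ 2 + ((Q₀ : ℝ) * 2 ^ j) ^ 3) * F2 := by
      intro j hj
      rw [mem_range] at hj
      set Qj : ℕ := Q₀ * 2 ^ j with hQj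
      have hQj0 : (0 : ℝ) < Qj := by rw [hQj]; positivity
      have hQjR : (Qj : ℝ) = (Q₀ : ℝ) * 2 ^ j := by rw [hQj]; push_cast; ring
      have hQjd : (Qj : ℝ) ≤ d₀ := by rw [hQj]; exact block_le hQ₀ hu hj
      -- fibre ⊆ block
      have hsub : Sq.filter (fun q => blockIdx Q₀ q = j) ⊆ Ioc Qj (2 * Qj) := by
        intro q hq
        rw [mem_filter, hSq, mem_filter] at hq
        obtain ⟨⟨-, hqQ⟩, hjq⟩ := hq
        have hb := mem_block_of_gt hQ₀ (not_le.mp hqQ)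
        rw [hjq, mem_Ioc] at hb
        rw [mem_Ioc, hQj]
        refine ⟨hb.1, hb.2.trans (le_of_eq ?_)⟩
        ring
      -- weight on the block
      have hwq : ∀ q ∈ Ioc Qj (2 * Qj), wt Δ₀ Dmax d₀ q ≤ 4 * (1 + Real.log (2 * d₀)) / Δ₀ * ((Qj : ℝ))⁻¹ := by
        intro q hq
        rw [mem_Ioc] at hq
        have hq1 : 1 ≤ q := by
          have : 1 ≤ Qj := by
            rw [hQj]; exact le_trans (by norm_num) (Nat.mul_le_mul hQ₀ Nat.one_le_two_pow)
          omega
        have hqR : (Qj : ℝ) < q := by exact_mod_cast hq.1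
        have hq2 : (q : ℝ) ≤ 2 * d₀ := by
          have : (q : ℝ) ≤ 2 * Qj := by exact_mod_cast hq.2
          linarith
        have hq0 : (0 : ℝ) < q := by linarith
        have hlog : Real.log q ≤ Real.log (2 * d₀) := Real.log_le_log hq0 hq2
        have hlog0 : 0 ≤ Real.log q := Real.log_nonneg (by exact_mod_cast hq1)
        calc wt Δ₀ Dmax d₀ q ≤ 4 * (1 + Real.log q) / (q * Δ₀) := hwt q hq1
          _ = 4 * (1 + Real.log q) / Δ₀ * ((q : ℝ))⁻¹ := by field_simp
          _ ≤ 4 * (1 + Real.log (2 * d₀)) / Δ₀ * ((Qj : ℝ))⁻¹ := by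
              gcongr
      have hLS := sum_Ustar_dyadic_le (a := a) (S₀ := S₀) (C := C) (subset_refl _) F Qj
      rw [← hN', ← hF2] at hLS
      calc ∑ q ∈ Sq.filter (fun q => blockIdx Q₀ q = j), wt Δ₀ Dmax d₀ q * Ustar F C q
          ≤ ∑ q ∈ Ioc Qj (2 * Qj), wt Δ₀ Dmax d₀ q * Ustar F C q :=
            sum_le_sum_of_subset_of_nonneg hsub fun q _ _ => mul_nonneg (wt_nonneg' q) (Ustar_nonneg _ _ _)
        _ ≤ ∑ q ∈ Ioc Qj (2 * Qj), (4 * (1 + Real.log (2 * d₀)) / Δ₀ * ((Qj : ℝ))⁻¹) * Ustar F C q :=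
            sum_le_sum fun q hq => mul_le_mul_of_nonneg_right (hwq q hq) (Ustar_nonneg _ _ _)
        _ = (4 * (1 + Real.log (2 * d₀)) / Δ₀ * ((Qj : ℝ))⁻¹) * ∑ q ∈ Ioc Qj (2 * Qj), Ustar F C q := by
            rw [mul_sum]
        _ ≤ (4 * (1 + Real.log (2 * d₀)) / Δ₀ * ((Qj : ℝ))⁻¹) *
              (51840 * ((N' : ℝ) ^ 3 + (Qj : ℝ) ^ 2 * (N' : ℝ) ^ 2 + (Qj : ℝ) ^ 4) * F2) :=
            mul_le_mul_of_nonneg_left hLS (by positivity)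
        _ = 4 * (1 + Real.log (2 * d₀)) / Δ₀ * 51840 *
              ((N' : ℝ) ^ 3 * ((Qj : ℝ))⁻¹ + (Qj : ℝ) * (N' : ℝ) ^ 2 + (Qj : ℝ) ^ 3) * F2 := by
            field_simp
        _ = _ := by rw [hQjR]
    refine (sum_le_sum hblock).trans ?_
    -- geometric sums
    obtain ⟨g1, g2, g3⟩ := geom_sums K
    have hK2 : (2 : ℝ) ^ K ≤ 2 * (d₀ / Q₀) := by
      rw [hK, pow_succ]
      have h1 : ((2 ^ Nat.log 2 ⌊d₀ / Q₀⌋₊ : ℕ) : ℝ) ≤ ⌊d₀ / Q₀⌋₊ := by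
        exact_mod_cast Nat.pow_log_le_self 2 (by omega)
      have h2 : (⌊d₀ / Q₀⌋₊ : ℝ) ≤ d₀ / Q₀ := Nat.floor_le (by positivity)
      push_cast at h1
      nlinarith
    have hK8 : (8 : ℝ) ^ K ≤ 8 * (d₀ / Q₀) ^ 3 := by
      have : (8 : ℝ) ^ K = ((2 : ℝ) ^ K) ^ 3 := by rw [← pow_mul, mul_comm, pow_mul]; norm_num
      rw [this]
      have h0 : (0 : ℝ) ≤ 2 ^ K := by positivity
      calc ((2 : ℝ) ^ K) ^ 3 ≤ (2 * (d₀ / Q₀)) ^ 3 := pow_le_pow_left₀ h0 hK2 3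
        _ = 8 * (d₀ / Q₀) ^ 3 := by ring
    have hsum1 : ∑ j ∈ range K, (N' : ℝ) ^ 3 * ((Q₀ : ℝ) * 2 ^ j)⁻¹ ≤ 2 * ((N' : ℝ) ^ 3 / Q₀) := by
      have e : ∀ j : ℕ, (N' : ℝ) ^ 3 * ((Q₀ : ℝ) * 2 ^ j)⁻¹ = ((N' : ℝ) ^ 3 / Q₀) * ((2 : ℝ) ^ j)⁻¹ := by
        intro j; field_simp
      simp_rw [e]
      rw [← mul_sum]
      calc (N' : ℝ) ^ 3 / Q₀ * ∑ j ∈ range K, ((2 : ℝ) ^ j)⁻¹ ≤ (N' : ℝ) ^ 3 / Q₀ * 2 := by gcongr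
        _ = 2 * ((N' : ℝ) ^ 3 / Q₀) := by ring
    have hsum2 : ∑ j ∈ range K, ((Q₀ : ℝ) * 2 ^ j) * (N' : ℝ) ^ 2 ≤ 2 * d₀ * (N' : ℝ) ^ 2 := by
      have e : ∀ j : ℕ, ((Q₀ : ℝ) * 2 ^ j) * (N' : ℝ) ^ 2 = ((Q₀ : ℝ) * (N' : ℝ) ^ 2) * (2 : ℝ) ^ j := by intro j; ring
      simp_rw [e]
      rw [← mul_sum]
      calc (Q₀ : ℝ) * (N' : ℝ) ^ 2 * ∑ j ∈ range K, (2 : ℝ) ^ j ≤ (Q₀ : ℝ) * (N' : ℝ) ^ 2 * (2 * (d₀ / Q₀)) := by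
            gcongr; exact g2.trans hK2
        _ = 2 * d₀ * (N' : ℝ) ^ 2 := by field_simp
    have hsum3 : ∑ j ∈ range K, ((Q₀ : ℝ) * 2 ^ j) ^ 3 ≤ 8 / 7 * d₀ ^ 3 := by
      have e : ∀ j : ℕ, ((Q₀ : ℝ) * 2 ^ j) ^ 3 = (Q₀ : ℝ) ^ 3 * (8 : ℝ) ^ j := by
        intro j; rw [mul_pow, ← pow_mul, mul_comm j 3, pow_mul]; norm_num
      simp_rw [e]
      rw [← mul_sum]
      calc (Q₀ : ℝ) ^ 3 * ∑ j ∈ range K, (8 : ℝ) ^ j ≤ (Q₀ : ℝ) ^ 3 * (8 * (d₀ / Q₀) ^ 3 / 7) := by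
            gcongr; exact g3.trans (by rw [div_le_div_iff_of_pos_right (by norm_num)]; exact hK8)
        _ = 8 / 7 * d₀ ^ 3 := by field_simp
    have hcoef0 : 0 ≤ 4 * (1 + Real.log (2 * d₀)) / Δ₀ * 51840 := by positivity
    calc ∑ j ∈ range K, 4 * (1 + Real.log (2 * d₀)) / Δ₀ * 51840 *
          ((N' : ℝ) ^ 3 * ((Q₀ : ℝ) * 2 ^ j)⁻¹ + ((Q₀ : ℝ) * 2 ^ j) * (N' : ℝ) ^ 2 + ((Q₀ : ℝ) * 2 ^ j) ^ 3) * F2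
        = 4 * (1 + Real.log (2 * d₀)) / Δ₀ * 51840 *
          (∑ j ∈ range K, ((N' : ℝ) ^ 3 * ((Q₀ : ℝ) * 2 ^ j)⁻¹ + ((Q₀ : ℝ) * 2 ^ j) * (N' : ℝ) ^ 2 + ((Q₀ : ℝ) * 2 ^ j) ^ 3)) * F2 := by
          rw [mul_sum, sum_mul]
      _ ≤ 4 * (1 + Real.log (2 * d₀)) / Δ₀ * 51840 *
          (2 * ((N' : ℝ) ^ 3 / Q₀) + 2 * d₀ * (N' : ℝ) ^ 2 + 8 / 7 * d₀ ^ 3) * F2 := by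
          rw [sum_add_distrib, sum_add_distrib]
          gcongr
      _ ≤ 414720 * (1 + Real.log (2 * d₀)) / Δ₀ * ((N' : ℝ) ^ 3 / Q₀ + d₀ * (N' : ℝ) ^ 2 + d₀ ^ 3) * F2 := by
          have h1 : 0 ≤ (N' : ℝ) ^ 3 / Q₀ := by positivity
          have h2 : 0 ≤ d₀ * (N' : ℝ) ^ 2 := by positivity
          have h3 : 0 ≤ d₀ ^ 3 := by positivity
          have hL : 0 ≤ (1 + Real.log (2 * d₀)) / Δ₀ := by positivity
          have stuff : 207360 * (2 * ((N' : ℝ) ^ 3 / Q₀) + 2 * d₀ * (N' : ℝ) ^ 2 + 8 / 7 * d₀ ^ 3) ≤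
              414720 * ((N' : ℝ) ^ 3 / Q₀ + d₀ * (N' : ℝ) ^ 2 + d₀ ^ 3) := by linarith
          have : 4 * (1 + Real.log (2 * d₀)) / Δ₀ * 51840 * (2 * ((N' : ℝ) ^ 3 / Q₀) + 2 * d₀ * (N' : ℝ) ^ 2 + 8 / 7 * d₀ ^ 3) ≤
              414720 * (1 + Real.log (2 * d₀)) / Δ₀ * ((N' : ℝ) ^ 3 / Q₀ + d₀ * (N' : ℝ) ^ 2 + d₀ ^ 3) := by
            calc 4 * (1 + Real.log (2 * d₀)) / Δ₀ * 51840 * (2 * ((N' : ℝ) ^ 3 / Q₀) + 2 * d₀ * (N' : ℝ) ^ 2 + 8 / 7 * d₀ ^ 3)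
                = ((1 + Real.log (2 * d₀)) / Δ₀) * (207360 * (2 * ((N' : ℝ) ^ 3 / Q₀) + 2 * d₀ * (N' : ℝ) ^ 2 + 8 / 7 * d₀ ^ 3)) := by
                  ring
              _ ≤ ((1 + Real.log (2 * d₀)) / Δ₀) * (414720 * ((N' : ℝ) ^ 3 / Q₀ + d₀ * (N' : ℝ) ^ 2 + d₀ ^ 3)) :=
                  mul_le_mul_of_nonneg_left stuff hL
              _ = _ := by ring
          exact mul_le_mul_of_nonneg_right this hF20
  where
    wt_nonneg' (q : ℕ) : 0 ≤ wt Δ₀ Dmax d₀ q := sum_nonneg fun _ _ => sum_nonneg fun _ _ => by positivity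


end Literature.NumberTheory.Sieve.CubicSieve.Twisted

end
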